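import Mathlib.Algebra.Polynomial.Taylor
import Mathlib.Algebra.CharP.Lemmas
import Mathlib.Data.Nat.Multiplicity
import Mathlib.RingTheory.LocalRing.ResidueField.Basic
import Mathlib.Data.Rat.Floor
import Literature.AlgebraicGeometry.Resolution.RegularLocalOrderValuation
import HarnessLib

/-!
# Benito–Villamayor 2013, §4–§5: slope of a `p`-presentation and the cleaning process — COEFFICIENT LEVEL

Topic: `Literature/AlgebraicGeometry/Resolution` (sibling of `RegularLocalOrderValuation.lean`, whose `adicOrder`
= `ν_y` is the order used throughout, and of `PowerSeriesCleaning.lean`, the purely inseparable special case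
`z^{pᵉ} + F(x)` of Hauser–Perlega). Source: A. Benito, O. E. Villamayor U., *Monoidal transforms and invariants of
singularities in positive characteristic*, Compositio Math. **149** (2013) 1267–1311 [BenitoVillamayoru2013];
locators «p.N l.M» below are pages/lines of the arXiv version arXiv:1004.1803v2 (33 pp., held text
`paper:arxiv-1004.1803`; line-numbered page texts and renders deposited by the campaign `res-hironaka` at
`run/shared/lean/pub/res-hironaka/lit/res-lit-3/bv2013/`, PDF sha256 `5caf9e97…3e97`), whose theorem numbering is
the one quoted (the publisher PDF is not held; journal numbering unverified).

## What the paper does (setting §1.1 p.1, §2.2 p.6: `V^{(d)}` smooth over a PERFECT field `k` of characteristic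
`p > 0`; Def. 2.14 pp.10–11: a `p`-presentation `p𝒫(β, z, f_{pᵉ}(z))` of a simple β-differential Rees algebra `𝒢` w.r.t.
a transversal projection `β : V^{(d)} → V^{(d−1)}`, with `f_{pᵉ}(z) = z^{pᵉ} + a₁ z^{pᵉ−1} + ⋯ + a_{pᵉ}`,
`a_i ∈ 𝒪_{V^{(d−1)}}`, and the elimination algebra `ℛ_{𝒢,β} ⊂ 𝒪_{V^{(d−1)}}[W]`)

* **Def. 4.2** (p.13 l.50–57): the SLOPE `Sl(p𝒫)(y) := min_{1≤j≤pᵉ} { ν_y(a_j)/j , ord(ℛ_{𝒢,β})(y) }`.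
* **Thm. 4.6** (p.14 l.43–48): if the minimum is attained at some `j < pᵉ` then `Sl(p𝒫)(y) = ord(ℛ_{𝒢,β})(y)`;
  in particular `Sl(p𝒫)(y) = min{ ν_y(a_{pᵉ})/pᵉ , ord(ℛ_{𝒢,β})(y) }`.
* **§5.1** (p.16 l.41–57), for `Sl(p𝒫)(y) > 0`: «A) `Sl(p𝒫)(y) = ord(ℛ_{𝒢,β})(y)`. B) `Sl(p𝒫)(y) = ν_y(a_{pᵉ})/pᵉ <
  ord(ℛ_{𝒢,β})(y)` (see Theorem 4.6), and B1) `ν_y(a_{pᵉ})/pᵉ ∉ ℤ_{>0}`. B2) `ν_y(a_{pᵉ})/pᵉ ∈ ℤ_{>0}` and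
  `In_y(a_{pᵉ})` is not a `pᵉ`-th power at `Gr_y(𝒪_{V^{(d−1)},y})`. B3) `ν_y(a_{pᵉ})/pᵉ ∈ ℤ_{>0}` and `In_y(a_{pᵉ})`
  is a `pᵉ`-th power at `Gr_y(𝒪_{V^{(d−1)},y})`.»
* **§5.2** (p.17 l.5–21): changes of the β-section `z′ = z + α`, `α ∈ 𝒪_{V^{(d−1)},y}` («(5.2.1) f_{pᵉ}(z) =
  f′_{pᵉ}(z′) = z′^{pᵉ} + a′₁ z′^{pᵉ−1} + ⋯ + a′_{pᵉ}», «(5.2.2) a′_{pᵉ} = α^{pᵉ} + a₁ α^{pᵉ−1} + ⋯ + a_{pᵉ}»; proof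
  of 5.3, p.17 l.52–54: «a′_n = Δ^{(pᵉ−n)}(f_{pᵉ})(α)»).
* **Prop. 5.3 (Cleaning process)** (p.17 l.23–30): «Assume that `Sl(p𝒫)(y) = ν_y(a_{pᵉ})/pᵉ < ord(ℛ_{𝒢,β})(y)`.
  There will be a change of the form `z′ = z + α`, defining a new presentation `p𝒫′` as in 5.2, so that
  `Sl(p𝒫)(y) < Sl(p𝒫′)(y)` if and only if case B3) holds in 5.1 for `p𝒫`.» (PROVED p.17 l.32 – p.18 l.8.)
* **Def. 5.5** (p.18 l.18–23): WELL-ADAPTED presentations; **Rem. 5.7** (p.18 l.29–44): «Finiteness of the cleaning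
  process … the slope will increase every time we come to Case B3). Finally, Remark 4.3 guarantees that Case B3) can
  arise only finitely many times throughout this procedure.»

## What is typed here, and in which generality (read before using)

The tree has no elimination algebras (Villamayor, Adv. Math. 213 (2007); Publ. RIMS 44 (2008)), so `ℛ_{𝒢,β}` cannot
be named; everything below is the COEFFICIENT-LEVEL content of §4–§5, which is where the printed proofs of Prop. 5.3
and Rem. 5.7 take place: the base local ring `S` stands for `𝒪_{V^{(d−1)},y}` (regular local, of characteristic `p`;
`ν_y` = `adicOrder`), the monic polynomial `f ∈ S[X]` of degree `q = pᵉ` stands for `f_{pᵉ}(z)` (coefficient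
`a_j` = coefficient of `z^{q−j}`, `coeffA`), and the ONE datum that is not a coefficient, the rational number
`ord(ℛ_{𝒢,β})(y)`, enters as an explicit parameter `ρ : ℚ`. Two renderings, both declared:
(i) case B) is typed in the SHARPENED form (5.3.1) «`ν_y(a_{pᵉ})/pᵉ < ν_y(a_i)/i` for `i = 1, …, pᵉ−1`» which the
printed proof of Prop. 5.3 derives from Thm. 4.6 in its first line (p.17 l.32–36) — Thm. 4.6 is a statement about
`ℛ_{𝒢,β}` (norms of `Δ^{(pᵉ−n)}(f)W^n` lie in it) and is NOT typed, so its consequence is carried as a hypothesis;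
(ii) «`In_y(a)` is a `pᵉ`-th power at `Gr_y(S)`» is typed as «some `α ∈ S` raises the order: `ν(α^{pᵉ} + a) > ν(a)`»
(`InitIsPow`), which is the form in which the printed proof uses it (p.18 l.7–8 «in case B3) it suffices to choose
α so that ν_y(α^{pᵉ} + a_{pᵉ}) > ν_y(a_{pᵉ})»; p.18 l.34–35 «α … such that In_y(α) = F»); for a regular local ring
(graded ring a polynomial ring, initial forms multiplicative) the two are equivalent for `a ≠ 0`.
With these renderings Prop. 5.3 and Rem. 5.7 are PROVED below (no named fact is introduced; Rem. 5.7's finiteness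
clause outright, `cleaning_chain_length_lt`, its existence clause «ultimately the procedure leads to a well-adapted
p-presentation» modulo Thm. 4.6's conclusion carried as a hypothesis, `exists_isWellAdapted_taylor`); Def. 4.2, §5.1,
Def. 5.5 are real definitions. The change of section is Mathlib's `Polynomial.taylor α f = f(X + α)` (so the new
section is `z′ = z − α`; (5.2.2) `a′_{pᵉ} = f(α)` fixes this convention, the words «z′ = z + α» of §5.2 being
insensitive to `α ↦ −α` for every order statement).

-- TODO(general form): the sheaf-level statements over `V^{(d−1)}` (presentations restricted to neighbourhoods,
-- §4.10), Thm. 4.6 and Main Theorem 1 (Thm. 7.2 / Cor. 7.3: `β`-independence of the well-adapted slope,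
-- `v-ord^{(d−1)}`) need the elimination algebra `ℛ_{𝒢,β}` and `p`-presentations (Def. 2.14) as objects.

## Contents
* `BV2013.coeffA`, `BV2013.ordQuot`, `BV2013.slope` (Def. 4.2), `BV2013.IsCaseA/IsCaseB/IsCaseB1/IsCaseB2/IsCaseB3`
  (§5.1 with (5.3.1)), `BV2013.SlopeIsPosInt`, `BV2013.InitIsPow`, `BV2013.IsWellAdapted` (Def. 5.5);
* `BV2013.coeffA_taylor_self` ((5.2.2) `a′_q = f(α)`), `BV2013.slope_eq_of_isCaseB`,
  `BV2013.exists_slope_lt_iff_initIsPow` (Prop. 5.3, coefficient form), `BV2013.slope_eq_natCast_of_isCaseB3`,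
  `BV2013.cleaning_chain_length_lt` (Rem. 5.7: a chain of B3-cleanings at `y` has length `< ρ`);
* `BV2013.SlopeDichotomy` (the conclusion of Thm. 4.6 for one presentation, as a hypothesis),
  `BV2013.isCaseA_or_isCaseB_of_slopeDichotomy` (§5.1 «A) or B) (see Theorem 4.6)»),
  `BV2013.isWellAdapted_or_isCaseB3_of_slopeDichotomy` (Rem. 5.7, one round: stop or B3)),
  `BV2013.exists_isWellAdapted_taylor` (Rem. 5.7, existence clause: a well-adapted presentation `f(X + α)` is reached,
  modulo Thm. 4.6);
* `BV2013.taylor_X_pow_add_C_charPow`, `BV2013.slopeDichotomy_X_pow_add_C`, `BV2013.exists_isWellAdapted_taylor_pure`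
  (pure heads `z^{pᵉ} + a`: Frobenius re-sectioning, Thm. 4.6 vacuous, Rem. 5.7's existence clause UNCONDITIONAL).
-/

noncomputable section

namespace Literature.AlgebraicGeometry.Resolution

namespace BV2013

open Polynomial IsLocalRing

universe u

variable {S : Type u} [CommRing S]

/-! ## Definitions (Def. 4.2, §5.1, Def. 5.5 — coefficient level) -/

/-- The coefficient `a_j` (`j = 1, …, q`) of a monic polynomial `f = z^q + a₁ z^{q−1} + ⋯ + a_q` of degree `q = pᵉ`
(the polynomial `f_{pᵉ}(z)` of a `p`-presentation, Def. 2.14 (ii) p.11): the coefficient of `z^{q−j}`.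
[cite: BenitoVillamayoru2013, Def. 2.14 (ii), arXiv v2 pp.10–11] -/
def coeffA (q : ℕ) (f : S[X]) (j : ℕ) : S :=
  f.coeff (q - j)

/-- `ν(x)/j ∈ ℚ ∪ {∞}`: the `𝔪`-adic order of `x ∈ S` (`adicOrder`, `= ν_y(x)` for `S = 𝒪_{V^{(d−1)},y}`) divided by `j`
(`⊤` for `x = 0`). Auxiliary for Def. 4.2. [cite: BenitoVillamayoru2013, Def. 4.2, arXiv v2 p.13 l.54–57] -/
def ordQuot [IsLocalRing S] (x : S) (j : ℕ) : WithTop ℚ :=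
  ENat.map (fun n : ℕ => ((n : ℚ) / (j : ℚ) : ℚ)) (adicOrder x)

/-- **Slope** of a `p`-presentation at `y`, COEFFICIENT FORM of Def. 4.2 «`Sl(p𝒫)(y) := min_{1≤j≤pᵉ} { ν_y(a_j)/j ,
ord(ℛ_{𝒢,β})(y) }`»: here `f = z^q + Σ a_j z^{q−j}` over `S = 𝒪_{V^{(d−1)},y}` and `ρ` STANDS FOR the rational number
`ord(ℛ_{𝒢,β})(y)` (the elimination algebra is not typed; TODO(general form) in the module docstring).
[cite: BenitoVillamayoru2013, Def. 4.2, arXiv v2 p.13 l.50–57] -/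
def slope [IsLocalRing S] (q : ℕ) (f : S[X]) (ρ : ℚ) : WithTop ℚ :=
  (Finset.Icc 1 q).inf (fun j => ordQuot (coeffA q f j) j) ⊓ ((ρ : ℚ) : WithTop ℚ)

/-- §5.1 case **A)** «`Sl(p𝒫)(y) = ord(ℛ_{𝒢,β})(y)`» (coefficient form, `ρ` for `ord(ℛ_{𝒢,β})(y)`).
[cite: BenitoVillamayoru2013, §5.1 A), arXiv v2 p.16 l.47] -/
def IsCaseA [IsLocalRing S] (q : ℕ) (f : S[X]) (ρ : ℚ) : Prop :=
  slope q f ρ = ((ρ : ℚ) : WithTop ℚ)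

/-- §5.1 case **B)** «`Sl(p𝒫)(y) = ν_y(a_{pᵉ})/pᵉ < ord(ℛ_{𝒢,β})(y)` (see Theorem 4.6)», typed in the SHARPENED form
(5.3.1) «`ν_y(a_{pᵉ})/pᵉ < ν_y(a_i)/i` for `i = 1, …, pᵉ − 1`» (p.17 l.32–36), which in print follows from case B) by
Thm. 4.6 (a theorem about the elimination algebra, not typed here) and is what the proof of Prop. 5.3 uses.
[cite: BenitoVillamayoru2013, §5.1 B) p.16 l.49 and (5.3.1) p.17 l.32–36, arXiv v2] -/
def IsCaseB [IsLocalRing S] (q : ℕ) (f : S[X]) (ρ : ℚ) : Prop :=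
  ordQuot (coeffA q f q) q < ((ρ : ℚ) : WithTop ℚ) ∧
    ∀ j ∈ Finset.Ico 1 q, ordQuot (coeffA q f q) q < ordQuot (coeffA q f j) j

/-- «`ν_y(a_{pᵉ})/pᵉ ∈ ℤ_{>0}`» (the integrality clause of §5.1 B1)/B2)/B3)): `ν(a_q) = ℓ·q` with `ℓ ≥ 1`.
[cite: BenitoVillamayoru2013, §5.1 B1)–B3), arXiv v2 p.16 l.51–55] -/
def SlopeIsPosInt [IsLocalRing S] (q : ℕ) (f : S[X]) : Prop :=
  ∃ ℓ : ℕ, 0 < ℓ ∧ adicOrder (coeffA q f q) = ((ℓ * q : ℕ) : ℕ∞)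

/-- «`In_y(a)` is a `q`-th power at `Gr_y(S)`» RENDERED as: some `α ∈ S` raises the order, `ν(α^q + a) > ν(a)` — the
form in which the printed proofs use it (Prop. 5.3, p.18 l.7–8: «in case B3) it suffices to choose α so that
ν_y(α^{pᵉ} + a_{pᵉ}) > ν_y(a_{pᵉ})»; Rem. 5.7, p.18 l.34–35). For a regular local ring (`Gr` a polynomial ring,
initial forms multiplicative and liftable) and `a ≠ 0` the two are equivalent (`In(a) = In(∓α)^q`; the sign is
absorbed by `(−1)^q = −1` for odd `q` and by `2 = 0` for `q = 2ᵉ` in characteristic `2`); for `a = 0`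
this rendering is `False` (never used: case B) forces `a_q ≠ 0`).
[cite: BenitoVillamayoru2013, §5.1 B3) p.16 l.55 with p.18 l.7–8, arXiv v2] -/
def InitIsPow [IsLocalRing S] (q : ℕ) (a : S) : Prop :=
  ∃ α : S, adicOrder a < adicOrder (α ^ q + a)

/-- §5.1 case **B1)** «`ν_y(a_{pᵉ})/pᵉ ∉ ℤ_{>0}`» (with B) in the form (5.3.1), see `IsCaseB`).
[cite: BenitoVillamayoru2013, §5.1 B1), arXiv v2 p.16 l.51] -/
def IsCaseB1 [IsLocalRing S] (q : ℕ) (f : S[X]) (ρ : ℚ) : Prop :=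
  IsCaseB q f ρ ∧ ¬ SlopeIsPosInt q f

/-- §5.1 case **B2)** «`ν_y(a_{pᵉ})/pᵉ ∈ ℤ_{>0}` and `In_y(a_{pᵉ})` is not a `pᵉ`-th power at `Gr_y(𝒪_{V^{(d−1)},y})`»
(renderings of `IsCaseB`, `InitIsPow`). [cite: BenitoVillamayoru2013, §5.1 B2), arXiv v2 p.16 l.53] -/
def IsCaseB2 [IsLocalRing S] (q : ℕ) (f : S[X]) (ρ : ℚ) : Prop :=
  IsCaseB q f ρ ∧ SlopeIsPosInt q f ∧ ¬ InitIsPow q (coeffA q f q)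

/-- §5.1 case **B3)** «`ν_y(a_{pᵉ})/pᵉ ∈ ℤ_{>0}` and `In_y(a_{pᵉ})` is a `pᵉ`-th power at `Gr_y(𝒪_{V^{(d−1)},y})`»
(renderings of `IsCaseB`, `InitIsPow`) — the only case in which cleaning raises the slope (Prop. 5.3).
[cite: BenitoVillamayoru2013, §5.1 B3), arXiv v2 p.16 l.55] -/
def IsCaseB3 [IsLocalRing S] (q : ℕ) (f : S[X]) (ρ : ℚ) : Prop :=
  IsCaseB q f ρ ∧ SlopeIsPosInt q f ∧ InitIsPow q (coeffA q f q)

/-- **Well-adapted** presentation at `y`, COEFFICIENT FORM of Def. 5.5: «(1) `Sl(p𝒫)(y) > 0` and either case A), case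
B1) or case B2) in 5.1 holds, (2) `Sl(p𝒫)(y) = 0` and A) `ord(ℛ_{𝒢,β})(y) = 0`, or B2) `ν_y(a_{pᵉ}) = 0 <
ord(ℛ_{𝒢,β})(y)` and `ā_{pᵉ} ∈ k(y)` is not a `pᵉ`-th power» (`k(y)` = `IsLocalRing.ResidueField S`, `ρ` for
`ord(ℛ_{𝒢,β})(y)`). [cite: BenitoVillamayoru2013, Def. 5.5, arXiv v2 p.18 l.18–23] -/
def IsWellAdapted [IsLocalRing S] (q : ℕ) (f : S[X]) (ρ : ℚ) : Prop :=
  (0 < slope q f ρ ∧ (IsCaseA q f ρ ∨ IsCaseB1 q f ρ ∨ IsCaseB2 q f ρ)) ∨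
    (slope q f ρ = 0 ∧
      (ρ = 0 ∨
        (adicOrder (coeffA q f q) = 0 ∧ 0 < ρ ∧
          ¬ ∃ b : ResidueField S, residue S (coeffA q f q) = b ^ q)))

/-! ## Elementary lemmas on `coeffA`, `ordQuot`, `slope` -/

/-- `a_q` is the constant term of `f_{pᵉ}(z) = z^{pᵉ} + a₁ z^{pᵉ−1} + ⋯ + a_{pᵉ}` (unfolding of `coeffA`).
[cite: BenitoVillamayoru2013, Def. 2.14 (ii), arXiv v2 pp.10–11] -/
@[simp] theorem coeffA_self (q : ℕ) (f : S[X]) : coeffA q f q = f.coeff 0 := by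
  simp [coeffA]

/-- `a_{q−i}` is the coefficient of `zⁱ` (unfolding of `coeffA`). [folklore] -/
private theorem coeffA_of_le {q j : ℕ} (f : S[X]) {i : ℕ} (hi : i ≤ q) (hj : j = q - i) :
    coeffA q f j = f.coeff i := by
  subst hj
  simp [coeffA, Nat.sub_sub_self hi]

/-- (5.2.2) in the `taylor` convention: the new last coefficient is `a′_q = f(α) = α^q + a₁ α^{q−1} + ⋯ + a_q`.
[cite: BenitoVillamayoru2013, (5.2.2), arXiv v2 p.17 l.19] -/
theorem coeffA_taylor_self (q : ℕ) (f : S[X]) (α : S) : coeffA q (taylor α f) q = f.eval α := by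
  rw [coeffA_self, taylor_coeff_zero]

section Local

variable [IsLocalRing S]

/-- The quotient `ν_y(x)/j` of Def. 4.2 for `ν_y(x) = m` finite is the rational number `m/j` (unfolding of `ordQuot`).
[cite: BenitoVillamayoru2013, Def. 4.2, arXiv v2 p.13 l.54–57] -/
theorem ordQuot_of_eq_natCast {x : S} {m : ℕ} (h : adicOrder x = (m : ℕ∞)) (j : ℕ) :
    ordQuot x j = (((m : ℚ) / (j : ℚ) : ℚ) : WithTop ℚ) := by
  simp only [ordQuot, h]
  rfl

/-- `ν(0)/j = ⊤` (unfolding of `ordQuot`). [folklore] -/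
private theorem ordQuot_of_eq_top {x : S} (h : adicOrder x = ⊤) (j : ℕ) : ordQuot x j = ⊤ := by
  simp only [ordQuot, h]
  rfl

/-- The comparison `ν_y(x)/q < ord(ℛ_{𝒢,β})(y)` of Def. 4.2 / §5.1 B) unfolds, for `ν_y(x) = m`, to `m/q < ρ`
(unfolding of `ordQuot`). [cite: BenitoVillamayoru2013, Def. 4.2 and §5.1 B), arXiv v2 p.13 l.54–57, p.16 l.49] -/
theorem ordQuot_lt_coe_iff {x : S} {m : ℕ} (h : adicOrder x = (m : ℕ∞)) (q : ℕ) (ρ : ℚ) :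
    ordQuot x q < ((ρ : ℚ) : WithTop ℚ) ↔ (m : ℚ) / (q : ℚ) < ρ := by
  rw [ordQuot_of_eq_natCast h]
  exact WithTop.coe_lt_coe

/-- If `ν(x)/q < ρ` then `x ≠ 0`, i.e. `ν(x)` is finite. [folklore] -/
private theorem exists_eq_natCast_of_ordQuot_lt_coe {x : S} {q : ℕ} {ρ : ℚ}
    (h : ordQuot x q < ((ρ : ℚ) : WithTop ℚ)) : ∃ m : ℕ, adicOrder x = (m : ℕ∞) := by
  induction hx : adicOrder x using ENat.recTopCoe with
  | top => exact absurd (ordQuot_of_eq_top hx q ▸ h) (not_lt_of_ge le_top)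
  | coe m => exact ⟨m, rfl⟩

/-- In a local ring: if `ν(x) = n` and `y ∈ 𝔪ⁿ⁺¹` then `ν(x + y) = n` (the order function is non-archimedean with
equality off the diagonal). [cite: ZariskiSamuel1960, Ch. VIII §1] -/
theorem adicOrder_add_eq_of_mem {x y : S} {n : ℕ} (hx : adicOrder x = (n : ℕ∞))
    (hy : y ∈ maximalIdeal S ^ (n + 1)) : adicOrder (x + y) = (n : ℕ∞) := by
  refine le_antisymm ?_ ?_
  · rw [adicOrder_le_iff]
    intro hxy
    have hx' : x ∈ maximalIdeal S ^ (n + 1) := by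
      have : x = (x + y) - y := by ring
      rw [this]
      exact sub_mem hxy hy
    exact (adicOrder_le_iff x n).mp hx.le hx'
  · rw [le_adicOrder_iff]
    exact add_mem ((le_adicOrder_iff x n).mp hx.ge) (Ideal.pow_le_pow_right (Nat.le_succ n) hy)

/-- A generic term `c · f_i · α^{i−k}` (`k ≤ i ≤ q`) with `f_i ∈ 𝔪^{(q−i)ℓ+1}` and `α ∈ 𝔪^ℓ` lies in `𝔪^{(q−k)ℓ+1}`
(the estimates (5.3.2)/(5.3.4)). [cite: BenitoVillamayoru2013, (5.3.2)–(5.3.4), arXiv v2 p.17 l.42–60] -/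
theorem term_mem_pow {q i k ℓ : ℕ} {fi α : S} (hfi : fi ∈ maximalIdeal S ^ ((q - i) * ℓ + 1))
    (hα : α ∈ maximalIdeal S ^ ℓ) (hki : k ≤ i) (hiq : i ≤ q) (c : S) :
    c * fi * α ^ (i - k) ∈ maximalIdeal S ^ ((q - k) * ℓ + 1) := by
  have hαi : α ^ (i - k) ∈ maximalIdeal S ^ (ℓ * (i - k)) := by
    rw [pow_mul]
    exact Ideal.pow_mem_pow hα _
  have hprod : fi * α ^ (i - k) ∈ maximalIdeal S ^ ((q - i) * ℓ + 1 + ℓ * (i - k)) := by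
    rw [pow_add]
    exact Ideal.mul_mem_mul hfi hαi
  have hexp : (q - i) * ℓ + 1 + ℓ * (i - k) = (q - k) * ℓ + 1 := by
    have h1 : q - k = (q - i) + (i - k) := by omega
    rw [h1, add_mul]
    ring
  rw [hexp] at hprod
  rw [mul_assoc]
  exact Ideal.mul_mem_left _ c hprod

end Local

section Noetherian

variable [IsLocalRing S] [IsNoetherianRing S]

/-- The inequality `ν_y(x)/q < ν_y(y)/j` ((5.3.1)) with `ν_y(x) = m` as a MEMBERSHIP: `y ∈ 𝔪^{⌊jm/q⌋ + 1}` — the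
translation used in (5.3.2). [cite: BenitoVillamayoru2013, (5.3.1)–(5.3.2), arXiv v2 p.17 l.32–46] -/
theorem mem_pow_of_ordQuot_lt {x y : S} {m q j : ℕ} (hx : adicOrder x = (m : ℕ∞)) (hq : 0 < q) (hj : 0 < j)
    (h : ordQuot x q < ordQuot y j) : y ∈ maximalIdeal S ^ (j * m / q + 1) := by
  induction hy : adicOrder y using ENat.recTopCoe with
  | top =>
    rw [(adicOrder_eq_top_iff y).mp hy]
    exact zero_mem _
  | coe n =>
    rw [ordQuot_of_eq_natCast hx, ordQuot_of_eq_natCast hy, WithTop.coe_lt_coe] at h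
    have hq' : (0 : ℚ) < q := by exact_mod_cast hq
    have hj' : (0 : ℚ) < j := by exact_mod_cast hj
    rw [div_lt_div_iff₀ hq' hj'] at h
    have hlt : j * m < n * q := by
      have : ((j * m : ℕ) : ℚ) < ((n * q : ℕ) : ℚ) := by push_cast; linarith
      exact_mod_cast this
    have hle : j * m / q + 1 ≤ n := Nat.succ_le_of_lt ((Nat.div_lt_iff_lt_mul hq).mpr hlt)
    exact Ideal.pow_le_pow_right hle ((le_adicOrder_iff y n).mp hy.ge)

omit [IsNoetherianRing S] in
/-- Conversely, a membership `y ∈ 𝔪^N` with `j·m < q·N` gives back the inequality `ν_y(x)/q < ν_y(y)/j` of (5.3.1)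
(for `ν_y(x) = m`). [cite: BenitoVillamayoru2013, (5.3.1)–(5.3.2), arXiv v2 p.17 l.32–46] -/
theorem ordQuot_lt_of_mem_pow {x y : S} {m q j N : ℕ} (hx : adicOrder x = (m : ℕ∞)) (hq : 0 < q) (hj : 0 < j)
    (hy : y ∈ maximalIdeal S ^ N) (hN : j * m < q * N) : ordQuot x q < ordQuot y j := by
  induction hy' : adicOrder y using ENat.recTopCoe with
  | top =>
    rw [ordQuot_of_eq_natCast hx, ordQuot_of_eq_top hy']
    exact WithTop.coe_lt_top _
  | coe n =>
    rw [ordQuot_of_eq_natCast hx, ordQuot_of_eq_natCast hy', WithTop.coe_lt_coe]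
    have hNn : N ≤ n := by
      have := (le_adicOrder_iff y N).mpr hy
      rw [hy'] at this
      exact_mod_cast this
    have hq' : (0 : ℚ) < q := by exact_mod_cast hq
    have hj' : (0 : ℚ) < j := by exact_mod_cast hj
    rw [div_lt_div_iff₀ hq' hj']
    have : m * j < n * q := by
      calc m * j = j * m := Nat.mul_comm m j
        _ < q * N := hN
        _ ≤ q * n := Nat.mul_le_mul_left q hNn
        _ = n * q := Nat.mul_comm q n
    exact_mod_cast this

end Noetherian

/-! ## The slope in case B) -/

section CaseB

variable [IsLocalRing S]

/-- In case B) (form (5.3.1)) the slope IS `ν(a_q)/q`: «`Sl(p𝒫)(y) = ν_y(a_{pᵉ})/pᵉ < ord(ℛ_{𝒢,β})(y)`».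
[cite: BenitoVillamayoru2013, §5.1 B), arXiv v2 p.16 l.49] -/
theorem slope_eq_of_isCaseB {q : ℕ} (hq : 0 < q) {f : S[X]} {ρ : ℚ} (h : IsCaseB q f ρ) :
    slope q f ρ = ordQuot (coeffA q f q) q := by
  refine le_antisymm ?_ ?_
  · exact inf_le_left.trans (Finset.inf_le (Finset.mem_Icc.mpr ⟨hq, le_rfl⟩))
  · refine le_inf (Finset.le_inf fun j hj => ?_) h.1.le
    rcases Finset.mem_Icc.mp hj with ⟨hj1, hjq⟩
    rcases hjq.lt_or_eq with hlt | rfl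
    · exact (h.2 j (Finset.mem_Ico.mpr ⟨hj1, hlt⟩)).le
    · exact le_rfl

/-- In case B3) the slope is the positive INTEGER `ℓ = ν(a_q)/q` («ν_y(a_{pᵉ}) = ℓpᵉ for some integer ℓ ≥ 1»,
Rem. 5.7), and `ℓ < ρ`. [cite: BenitoVillamayoru2013, Rem. 5.7, arXiv v2 p.18 l.30] -/
theorem slope_eq_natCast_of_isCaseB3 {q : ℕ} (hq : 0 < q) {f : S[X]} {ρ : ℚ} (h : IsCaseB3 q f ρ) :
    ∃ ℓ : ℕ, 0 < ℓ ∧ slope q f ρ = ((ℓ : ℚ) : WithTop ℚ) ∧ (ℓ : ℚ) < ρ := by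
  obtain ⟨hB, ⟨ℓ, hℓ, hord⟩, -⟩ := h
  have hq' : (q : ℚ) ≠ 0 := by exact_mod_cast hq.ne'
  have hval : ((ℓ * q : ℕ) : ℚ) / (q : ℚ) = ℓ := by
    push_cast
    field_simp
  refine ⟨ℓ, hℓ, ?_, ?_⟩
  · rw [slope_eq_of_isCaseB hq hB, ordQuot_of_eq_natCast hord, hval]
  · have := (ordQuot_lt_coe_iff hord q ρ).mp hB.1
    rwa [hval] at this

end CaseB

/-! ## Remark 5.7: finiteness of the cleaning process -/

/-- **Rem. 5.7 (Finiteness of the cleaning process)**, coefficient form: along any chain `f₀, f₁, …, f_n` of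
presentations at `y` in which every `f_k` (`k < n`) is in case B3) and each step RAISES the slope («the slope will
increase every time we come to Case B3)»), the slopes are integers `1 ≤ ℓ₀ < ℓ₁ < ⋯ < ℓ_{n−1} < ρ`; hence such a chain
has fewer than `ρ = ord(ℛ_{𝒢,β})(y)` steps («Remark 4.3 guarantees that Case B3) can arise only finitely many times
throughout this procedure»). The chain need not consist of cleanings — only the slopes are used, as in print.
[cite: BenitoVillamayoru2013, Rem. 5.7, arXiv v2 p.18 l.29–44] -/
theorem cleaning_chain_length_lt [IsLocalRing S] {q : ℕ} (hq : 0 < q) (ρ : ℚ) (c : ℕ → S[X]) (n : ℕ)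
    (hn : 0 < n) (h : ∀ k < n, IsCaseB3 q (c k) ρ ∧ slope q (c k) ρ < slope q (c (k + 1)) ρ) :
    (n : ℚ) < ρ := by
  -- `(k + 1 : ℚ) ≤ slope (c k)` for every `k < n`, by induction on `k`
  have key : ∀ k < n, (((k + 1 : ℕ) : ℚ) : WithTop ℚ) ≤ slope q (c k) ρ := by
    intro k
    induction k with
    | zero =>
      intro h0
      obtain ⟨ℓ, hℓ, hs, -⟩ := slope_eq_natCast_of_isCaseB3 hq (h 0 h0).1
      rw [hs]
      exact_mod_cast Nat.succ_le_of_lt hℓ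
    | succ k ih =>
      intro hk
      have hk' : k < n := Nat.lt_of_succ_lt hk
      obtain ⟨ℓ, -, hs, -⟩ := slope_eq_natCast_of_isCaseB3 hq (h k hk').1
      obtain ⟨ℓ', -, hs', -⟩ := slope_eq_natCast_of_isCaseB3 hq (h (k + 1) hk).1
      have hstep := (h k hk').2
      have hih := ih hk'
      rw [hs] at hih hstep
      rw [hs'] at hstep ⊢
      have h1 : (((k + 1 : ℕ) : ℚ)) ≤ ℓ := by exact_mod_cast hih
      have h2 : ((ℓ : ℚ)) < ℓ' := by exact_mod_cast hstep
      have h3 : k + 1 ≤ ℓ := by exact_mod_cast h1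
      have h4 : ℓ < ℓ' := by exact_mod_cast h2
      exact_mod_cast (show k + 1 + 1 ≤ ℓ' by omega)
  obtain ⟨ℓ, -, hs, hρ⟩ := slope_eq_natCast_of_isCaseB3 hq (h (n - 1) (Nat.sub_lt hn Nat.one_pos)).1
  have := key (n - 1) (Nat.sub_lt hn Nat.one_pos)
  rw [hs, Nat.sub_add_cancel hn] at this
  have hnl : (n : ℚ) ≤ ℓ := by exact_mod_cast this
  exact lt_of_le_of_lt hnl hρ

/-! ## Polynomial bookkeeping: `f(α)` and the coefficients of `f(X + α)` -/

/-- The coefficients of `taylor α f = f(X + α)` as the sums «`a′_n = Δ^{(pᵉ−n)}(f_{pᵉ})(α)`» (Hasse derivatives):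
`(taylor α f).coeff k = Σ_{i<n} C(i+k, k) f_{i+k} α^i` for any `n > deg f`.
[cite: BenitoVillamayoru2013, proof of Prop. 5.3, arXiv v2 p.17 l.52–54] -/
theorem taylor_coeff_eq_sum (f : S[X]) (α : S) (k : ℕ) {n : ℕ} (hn : f.natDegree < n) :
    (taylor α f).coeff k =
      ∑ i ∈ Finset.range n, (((i + k).choose k : ℕ) : S) * f.coeff (i + k) * α ^ i := by
  rw [taylor_coeff, eval_eq_sum_range'
    ((natDegree_hasseDeriv_le f k).trans_lt (lt_of_le_of_lt (Nat.sub_le _ _) hn))]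
  refine Finset.sum_congr rfl fun i _ => ?_
  rw [hasseDeriv_coeff]

/-- The value `f(α) = α^q + a_q + Σ_{1≤i≤q−1} f_i αⁱ` of a monic `f` of degree `q` ((5.2.2)/(5.3.3): «a′_{pᵉ} =
α^{pᵉ} + A + a_{pᵉ}»). [cite: BenitoVillamayoru2013, (5.3.3), arXiv v2 p.17 l.48–50] -/
theorem eval_eq_pow_add_coeff_zero_add_sum {q : ℕ} (hq : 0 < q) {f : S[X]} (hmon : f.Monic)
    (hdeg : f.natDegree = q) (α : S) :
    f.eval α = α ^ q + f.coeff 0 + ∑ i ∈ Finset.range (q - 1), f.coeff (i + 1) * α ^ (i + 1) := by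
  rw [eval_eq_sum_range, hdeg, Finset.sum_range_succ]
  have hlead : f.coeff q = 1 := by rw [← hdeg]; exact hmon.coeff_natDegree
  rw [hlead, one_mul]
  obtain ⟨q', rfl⟩ : ∃ q', q = q' + 1 := ⟨q - 1, (Nat.sub_add_cancel hq).symm⟩
  rw [Finset.sum_range_succ', pow_zero, mul_one, Nat.add_sub_cancel]
  ring

/-! ## Proposition 5.3: the cleaning process (coefficient form) -/

section Cleaning

variable [IsRegularLocalRing S]

/-- If `ν(α^q + a) > ν(a) = m` then `q·ν(α) = m`: the order of `α` is the integer `ℓ = m/q` («ν_y(a_{pᵉ}) = ℓpᵉ …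
In_y(α) = F», Rem. 5.7). [cite: BenitoVillamayoru2013, Rem. 5.7, arXiv v2 p.18 l.30–35] -/
theorem exists_order_eq_of_lt {q : ℕ} (hq : 0 < q) {a α : S} {m : ℕ} (ha : adicOrder a = (m : ℕ∞))
    (h : adicOrder a < adicOrder (α ^ q + a)) : ∃ ℓ : ℕ, m = ℓ * q ∧ adicOrder α = (ℓ : ℕ∞) := by
  induction hα : adicOrder α using ENat.recTopCoe with
  | top =>
    have hα0 : α = 0 := (adicOrder_eq_top_iff α).mp hα
    rw [hα0, zero_pow hq.ne', zero_add] at h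
    exact absurd h (lt_irrefl _)
  | coe ℓ =>
    have hpow : adicOrder (α ^ q) = ((q * ℓ : ℕ) : ℕ∞) := by
      rw [adicOrder_pow, hα]; norm_cast
    rcases Nat.lt_trichotomy (q * ℓ) m with hlt | heq | hgt
    · -- `ν(α^q + a) = qℓ < m`: contradiction
      have ha' : a ∈ maximalIdeal S ^ (q * ℓ + 1) :=
        Ideal.pow_le_pow_right (Nat.succ_le_of_lt hlt) ((le_adicOrder_iff a m).mp ha.ge)
      have := adicOrder_add_eq_of_mem hpow ha'
      rw [this, ha] at h
      exact absurd (show m < q * ℓ by exact_mod_cast h) (Nat.lt_asymm hlt)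
    · exact ⟨ℓ, by rw [← heq, Nat.mul_comm], rfl⟩
    · -- `ν(a + α^q) = m`: contradiction
      have hα' : α ^ q ∈ maximalIdeal S ^ (m + 1) :=
        Ideal.pow_le_pow_right (Nat.succ_le_of_lt hgt) ((le_adicOrder_iff _ _).mp hpow.ge)
      have := adicOrder_add_eq_of_mem ha hα'
      rw [add_comm] at this
      rw [this, ha] at h
      exact absurd h (lt_irrefl _)

/-- **Prop. 5.3 (Cleaning process), coefficient form.** `S` a regular local ring of characteristic `p` (for
`𝒪_{V^{(d−1)},y}`), `f ∈ S[X]` monic of degree `q = pᵉ` (for `f_{pᵉ}(z)`), `ρ` for `ord(ℛ_{𝒢,β})(y)`, in case B)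
in the form (5.3.1) (`IsCaseB`). Then SOME change of section `f ↦ f(X + α)` (`Polynomial.taylor α`) RAISES the slope
if and only if case B3) holds, i.e. iff `In_y(a_q)` is a `q`-th power (`InitIsPow` rendering): «There will be a
change of the form z′ = z + α, defining a new presentation p𝒫′ as in 5.2, so that Sl(p𝒫)(y) < Sl(p𝒫′)(y) if and
only if case B3) holds in 5.1 for p𝒫.» (The integrality clause of B3) is automatic, `exists_order_eq_of_lt`; its
positivity «`∈ ℤ_{>0}`» is print's standing assumption `Sl(p𝒫)(y) > 0` (§5.2 p.17 l.6), which this theorem does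
not need — for slope `0` the right-hand side is the condition of Rem. 5.4, p.18 l.14–16, instead of B3).)
Proof as printed: (5.3.1)–(5.3.4), `p ∣ C(pᵉ, m)` for `0 < m < pᵉ`, and (5.3.3) `a′_{pᵉ} = α^{pᵉ} + A + a_{pᵉ}`.
[cite: BenitoVillamayoru2013, Prop. 5.3, arXiv v2 p.17 l.23–29 (proof p.17 l.32 – p.18 l.8)] -/
theorem exists_slope_lt_iff_initIsPow {p : ℕ} (hp : p.Prime) [CharP S p] (e : ℕ) {f : S[X]} (hmon : f.Monic)
    (hdeg : f.natDegree = p ^ e) {ρ : ℚ} (hB : IsCaseB (p ^ e) f ρ) :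
    (∃ α : S, slope (p ^ e) f ρ < slope (p ^ e) (taylor α f) ρ) ↔ InitIsPow (p ^ e) (coeffA (p ^ e) f (p ^ e)) := by
  set q := p ^ e with hqdef
  have hq : 0 < q := pow_pos hp.pos e
  have hq1 : 1 ≤ q := hq
  -- `m = ν(a_q)` is finite
  obtain ⟨m, hm⟩ := exists_eq_natCast_of_ordQuot_lt_coe hB.1
  rw [coeffA_self] at hm
  have hslope : slope q f ρ = ordQuot (f.coeff 0) q := by rw [slope_eq_of_isCaseB hq hB, coeffA_self]
  -- (5.3.1) as memberships: `f_i ∈ 𝔪^{⌊(q−i)m/q⌋+1}` for `1 ≤ i ≤ q − 1`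
  have hBi : ∀ i, 1 ≤ i → i < q → f.coeff i ∈ maximalIdeal S ^ ((q - i) * m / q + 1) := by
    intro i hi1 hiq
    have hj : q - i ∈ Finset.Ico 1 q := Finset.mem_Ico.mpr ⟨by omega, by omega⟩
    have := hB.2 (q - i) hj
    rw [coeffA_self, coeffA_of_le f hiq.le rfl] at this
    exact mem_pow_of_ordQuot_lt hm hq (by omega) this
  constructor
  · -- (⇒): a slope-raising `α` kills the initial form of `a_q`
    rintro ⟨α, hα⟩
    rw [hslope] at hα
    -- the new last coefficient `f(α)` has `ν > m`
    have hlast : ordQuot (f.coeff 0) q < ordQuot ((taylor α f).coeff 0) q := by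
      have h1 : ordQuot (f.coeff 0) q < (Finset.Icc 1 q).inf (fun j => ordQuot (coeffA q (taylor α f) j) j) :=
        (lt_inf_iff.mp hα).1
      have h2 := (Finset.lt_inf_iff (by rw [ordQuot_of_eq_natCast hm]; exact WithTop.coe_lt_top _)).mp h1 q
        (Finset.mem_Icc.mpr ⟨hq1, le_rfl⟩)
      rwa [coeffA_self] at h2
    have hev : f.eval α ∈ maximalIdeal S ^ (m + 1) := by
      have := mem_pow_of_ordQuot_lt hm hq hq hlast
      rwa [taylor_coeff_zero, Nat.mul_div_cancel_left m hq] at this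
    rw [eval_eq_pow_add_coeff_zero_add_sum hq hmon hdeg] at hev
    refine ⟨α, ?_⟩
    rw [coeffA_self, hm]
    -- case analysis on `ν(α)`
    induction hαo : adicOrder α using ENat.recTopCoe with
    | top =>
      -- `α = 0`: then `f(0) = a_q ∈ 𝔪^{m+1}`, contradicting `ν(a_q) = m`
      exfalso
      have hα0 : α = 0 := (adicOrder_eq_top_iff α).mp hαo
      subst hα0
      have hA : ∑ i ∈ Finset.range (q - 1), f.coeff (i + 1) * (0 : S) ^ (i + 1) = 0 := by
        refine Finset.sum_eq_zero fun i _ => ?_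
        rw [zero_pow (Nat.succ_ne_zero i), mul_zero]
      rw [hA, zero_pow hq.ne', zero_add, add_zero] at hev
      exact (adicOrder_le_iff _ m).mp hm.le hev
    | coe ℓ' =>
      have hαmem : α ∈ maximalIdeal S ^ ℓ' := (le_adicOrder_iff α ℓ').mp hαo.ge
      by_cases hcase : q * ℓ' < m
      · -- `qν(α) < m`: then `ν(f(α)) = qℓ' < m + 1`, contradicting `f(α) ∈ 𝔪^{m+1}`
        exfalso
        have hpow : adicOrder (α ^ q) = ((q * ℓ' : ℕ) : ℕ∞) := by
          rw [adicOrder_pow, hαo]; norm_cast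
        -- `a_q + A ∈ 𝔪^{qℓ'+1}`
        have hrest : f.coeff 0 + ∑ i ∈ Finset.range (q - 1), f.coeff (i + 1) * α ^ (i + 1) ∈
            maximalIdeal S ^ (q * ℓ' + 1) := by
          refine add_mem ?_ (Submodule.sum_mem _ fun i hi => ?_)
          · exact Ideal.pow_le_pow_right (Nat.succ_le_of_lt hcase) ((le_adicOrder_iff _ m).mp hm.ge)
          · have hi' := Finset.mem_range.mp hi
            have hfi := hBi (i + 1) (by omega) (by omega)
            -- `⌊(q−i−1)m/q⌋ ≥ (q−i−1)ℓ'`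
            have hN : (q - (i + 1)) * ℓ' + 1 ≤ (q - (i + 1)) * m / q + 1 := by
              have : (q - (i + 1)) * ℓ' ≤ (q - (i + 1)) * m / q := by
                calc (q - (i + 1)) * ℓ' = (q - (i + 1)) * (q * ℓ') / q := by
                      rw [← Nat.mul_assoc, Nat.mul_comm (q - (i + 1)) q, Nat.mul_assoc,
                        Nat.mul_div_cancel_left _ hq]
                  _ ≤ (q - (i + 1)) * m / q := Nat.div_le_div_right (Nat.mul_le_mul_left _ hcase.le)
              omega
            have hfi' : f.coeff (i + 1) ∈ maximalIdeal S ^ ((q - (i + 1)) * ℓ' + 1) :=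
              Ideal.pow_le_pow_right hN hfi
            have := term_mem_pow (k := 0) hfi' hαmem (Nat.zero_le _) (by omega) 1
            rw [one_mul, Nat.sub_zero, Nat.sub_zero] at this
            exact this
        have hval : adicOrder (α ^ q + (f.coeff 0 +
            ∑ i ∈ Finset.range (q - 1), f.coeff (i + 1) * α ^ (i + 1))) = ((q * ℓ' : ℕ) : ℕ∞) :=
          adicOrder_add_eq_of_mem hpow hrest
        rw [← add_assoc] at hval
        have hge : ((m + 1 : ℕ) : ℕ∞) ≤ ((q * ℓ' : ℕ) : ℕ∞) := by
          rw [← hval]; exact (le_adicOrder_iff _ _).mpr hev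
        have : m + 1 ≤ q * ℓ' := by exact_mod_cast hge
        omega
      · -- `qν(α) ≥ m`: then `A ∈ 𝔪^{m+1}` by (5.3.2), hence `α^q + a_q ∈ 𝔪^{m+1}`
        replace hcase : m ≤ q * ℓ' := not_lt.mp hcase
        have hA : ∑ i ∈ Finset.range (q - 1), f.coeff (i + 1) * α ^ (i + 1) ∈ maximalIdeal S ^ (m + 1) := by
          refine Submodule.sum_mem _ fun i hi => ?_
          have hi' := Finset.mem_range.mp hi
          have hfi := hBi (i + 1) (by omega) (by omega)
          -- exponent bookkeeping: `N + (i+1)ℓ' ≥ m + 1` where `N = ⌊(q−i−1)m/q⌋ + 1`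
          set N := (q - (i + 1)) * m / q + 1 with hNdef
          have hqN : (q - (i + 1)) * m < q * N := by
            have := Nat.lt_div_mul_add (a := (q - (i + 1)) * m) hq
            rw [hNdef, Nat.mul_add, Nat.mul_one, Nat.mul_comm q]
            exact this
          have hkey : m + 1 ≤ N + ℓ' * (i + 1) := by
            have h1 : q * (N + ℓ' * (i + 1)) > q * m := by
              have hsplit : q * m = (q - (i + 1)) * m + (i + 1) * m := by
                rw [← Nat.add_mul, Nat.sub_add_cancel (by omega : i + 1 ≤ q)]
              calc q * (N + ℓ' * (i + 1)) = q * N + (i + 1) * (q * ℓ') := by ring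
                _ ≥ q * N + (i + 1) * m := by
                    exact Nat.add_le_add_left (Nat.mul_le_mul_left _ hcase) _
                _ > (q - (i + 1)) * m + (i + 1) * m := Nat.add_lt_add_right hqN _
                _ = q * m := hsplit.symm
            exact Nat.succ_le_of_lt (Nat.lt_of_mul_lt_mul_left h1)
          have hαi : α ^ (i + 1) ∈ maximalIdeal S ^ (ℓ' * (i + 1)) := by
            rw [pow_mul]; exact Ideal.pow_mem_pow hαmem _
          have hprod : f.coeff (i + 1) * α ^ (i + 1) ∈ maximalIdeal S ^ (N + ℓ' * (i + 1)) := by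
            rw [pow_add]; exact Ideal.mul_mem_mul hfi hαi
          exact Ideal.pow_le_pow_right hkey hprod
        have hsum : α ^ q + f.coeff 0 ∈ maximalIdeal S ^ (m + 1) := by
          have : α ^ q + f.coeff 0 = (α ^ q + f.coeff 0 +
              ∑ i ∈ Finset.range (q - 1), f.coeff (i + 1) * α ^ (i + 1)) -
              ∑ i ∈ Finset.range (q - 1), f.coeff (i + 1) * α ^ (i + 1) := by ring
          rw [this]
          exact sub_mem hev hA
        have := (le_adicOrder_iff _ _).mpr hsum
        exact lt_of_lt_of_le (by exact_mod_cast Nat.lt_succ_self m) this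
  · -- (⇐): in case B3) the lift `α` of the `q`-th root of the initial form raises the slope
    rintro ⟨α, hα⟩
    rw [coeffA_self] at hα
    obtain ⟨ℓ, hmℓ, hαo⟩ := exists_order_eq_of_lt hq hm hα
    have hα' : ((m : ℕ) : ℕ∞) < adicOrder (α ^ q + f.coeff 0) := by rw [← hm]; exact hα
    have hαmem : α ∈ maximalIdeal S ^ ℓ := (le_adicOrder_iff α ℓ).mp hαo.ge
    -- (5.3.1) in exact form: `f_i ∈ 𝔪^{(q−i)ℓ+1}`
    have hBi' : ∀ i, 1 ≤ i → i < q → f.coeff i ∈ maximalIdeal S ^ ((q - i) * ℓ + 1) := by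
      intro i hi1 hiq
      have := hBi i hi1 hiq
      rwa [hmℓ, ← Nat.mul_assoc, Nat.mul_div_cancel _ hq] at this
    -- every new coefficient: `f'_k ∈ 𝔪^{(q−k)ℓ+1}` for `k < q` (so `a′_j ∈ 𝔪^{jℓ+1}`)
    have hnew : ∀ k, k < q → (taylor α f).coeff k ∈ maximalIdeal S ^ ((q - k) * ℓ + 1) := by
      intro k hk
      rcases Nat.eq_zero_or_pos k with rfl | hkpos
      · -- `k = 0`: `f(α) = (α^q + a_q) + A`
        rw [taylor_coeff_zero, eval_eq_pow_add_coeff_zero_add_sum hq hmon hdeg, Nat.sub_zero]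
        refine add_mem ?_ (Submodule.sum_mem _ fun i hi => ?_)
        · have h1 : ((m + 1 : ℕ) : ℕ∞) ≤ adicOrder (α ^ q + f.coeff 0) := by
            have := Order.add_one_le_of_lt hα'
            exact_mod_cast this
          have h2 : q * ℓ + 1 = m + 1 := by rw [hmℓ, Nat.mul_comm]
          rw [h2]
          exact (le_adicOrder_iff _ _).mp h1
        · have hi' := Finset.mem_range.mp hi
          have := term_mem_pow (k := 0) (hBi' (i + 1) (by omega) (by omega)) hαmem (Nat.zero_le _)
            (by omega) 1
          rwa [one_mul, Nat.sub_zero, Nat.sub_zero] at this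
      · -- `1 ≤ k ≤ q − 1`: Hasse-derivative expansion; the top term dies since `p ∣ C(pᵉ, k)`
        rw [taylor_coeff_eq_sum f α k (n := q + 1) (by omega)]
        refine Submodule.sum_mem _ fun i hi => ?_
        rcases Nat.lt_trichotomy (i + k) q with hlt | heq | hgt
        · -- genuine term `C · f_{i+k} · α^i`, `k ≤ i + k ≤ q − 1`
          have := term_mem_pow (k := k) (i := i + k) (hBi' (i + k) (by omega) hlt) hαmem (by omega) hlt.le
            ((((i + k).choose k : ℕ) : S))
          rwa [Nat.add_sub_cancel] at this
        · -- `i + k = q`: the binomial coefficient `C(pᵉ, k)` vanishes in characteristic `p`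
          have hdvd : p ∣ (i + k).choose k := by
            rw [heq, hqdef]
            exact hp.dvd_choose_pow (by omega) (by rw [← hqdef]; omega)
          have hzero : ((((i + k).choose k : ℕ)) : S) = 0 := (CharP.cast_eq_zero_iff S p _).mpr hdvd
          rw [hzero, zero_mul, zero_mul]
          exact zero_mem _
        · -- `i + k > q = deg f`: the coefficient is `0`
          have : f.coeff (i + k) = 0 := coeff_eq_zero_of_natDegree_lt (by omega)
          rw [this, mul_zero, zero_mul]
          exact zero_mem _
    -- conclusion: `slope f = m/q = ℓ < slope f'`
    refine ⟨α, ?_⟩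
    rw [hslope, slope]
    refine lt_inf_iff.mpr ⟨?_, by rw [← coeffA_self]; exact hB.1⟩
    refine (Finset.lt_inf_iff (by rw [ordQuot_of_eq_natCast hm]; exact WithTop.coe_lt_top _)).mpr
      fun j hj => ?_
    rcases Finset.mem_Icc.mp hj with ⟨hj1, hjq⟩
    have hk : q - j < q := by omega
    have hmem := hnew (q - j) hk
    rw [Nat.sub_sub_self hjq] at hmem
    refine ordQuot_lt_of_mem_pow hm hq (by omega) (by simpa [coeffA] using hmem) ?_
    -- `j·m = j·ℓ·q < q·(jℓ + 1)`
    rw [hmℓ]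
    nlinarith

end Cleaning

/-! ## Remark 5.7, existence clause: a well-adapted presentation is reached (modulo Thm. 4.6) -/

section Existence

variable [IsLocalRing S]

/-- The CONCLUSION of Thm. 4.6 for ONE presentation `g = z^q + Σ a_j z^{q−j}` at `y` (coefficient form, `ρ` for
`ord(ℛ_{𝒢,β})(y)`), used below only as a HYPOTHESIS: «If `Sl(p𝒫)(y) = ν_y(a_j)/j` for some index
`j ∈ {1, …, pᵉ − 1}`, then `Sl(p𝒫)(y) = ord(ℛ_{𝒢,β})(y)`.» Thm. 4.6 itself is a theorem about the elimination
algebra `ℛ_{𝒢,β}` (the norm of `Δ^{(pᵉ−n)}(f_{pᵉ})Wⁿ ∈ 𝒢` lies in `ℛ_{𝒢,β}`, proof p.14 l.50 – p.15) and is NOT typed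
in the tree (TODO(general form) of the module docstring); in print it holds for EVERY `p`-presentation of `𝒢` w.r.t.
`β`, in particular for every change of section `z′ = z + α` (§5.2), which is how `exists_isWellAdapted_taylor` consumes
it. This is a predicate on the data `(q, g, ρ)`, not a named fact.
[cite: BenitoVillamayoru2013, Thm. 4.6, arXiv v2 p.14 l.43–45] -/
def SlopeDichotomy (q : ℕ) (g : S[X]) (ρ : ℚ) : Prop :=
  ∀ j ∈ Finset.Ico 1 q, slope q g ρ = ordQuot (coeffA q g j) j → slope q g ρ = ((ρ : ℚ) : WithTop ℚ)

/-- Under the conclusion of Thm. 4.6 the case distinction of §5.1 is exhaustive at coefficient level: case A), or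
case B) in the sharpened form (5.3.1) (`IsCaseB`) — «B) `Sl(p𝒫)(y) = ν_y(a_{pᵉ})/pᵉ < ord(ℛ_{𝒢,β})(y)` (see
Theorem 4.6)»: a tie `ν_y(a_j)/j = Sl(p𝒫)(y) < ord(ℛ_{𝒢,β})(y)` with `j < pᵉ` is what Thm. 4.6 excludes.
[cite: BenitoVillamayoru2013, §5.1 p.16 l.47–49 with Thm. 4.6 p.14 l.43–45, arXiv v2] -/
theorem isCaseA_or_isCaseB_of_slopeDichotomy {q : ℕ} (hq : 0 < q) {g : S[X]} {ρ : ℚ}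
    (h46 : SlopeDichotomy q g ρ) : IsCaseA q g ρ ∨ IsCaseB q g ρ := by
  classical
  by_cases hA : slope q g ρ = ((ρ : ℚ) : WithTop ℚ)
  · exact Or.inl hA
  right
  have hne : (Finset.Icc 1 q).Nonempty := ⟨q, Finset.mem_Icc.mpr ⟨hq, le_rfl⟩⟩
  obtain ⟨j₀, hj₀, hinf⟩ :=
    Finset.exists_mem_eq_inf (Finset.Icc 1 q) hne (fun j => ordQuot (coeffA q g j) j)
  have hlt : slope q g ρ < ((ρ : ℚ) : WithTop ℚ) := lt_of_le_of_ne inf_le_right hA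
  -- `slope = min_j ν(a_j)/j` since the slope is not `ρ`
  have hsF : slope q g ρ = (Finset.Icc 1 q).inf (fun j => ordQuot (coeffA q g j) j) := by
    have hdef : slope q g ρ =
        (Finset.Icc 1 q).inf (fun j => ordQuot (coeffA q g j) j) ⊓ ((ρ : ℚ) : WithTop ℚ) := rfl
    rcases le_total ((Finset.Icc 1 q).inf (fun j => ordQuot (coeffA q g j) j)) ((ρ : ℚ) : WithTop ℚ) with h | h
    · rw [hdef, inf_eq_left.mpr h]
    · exact absurd (by rw [hdef, inf_eq_right.mpr h]) hA
  -- the minimum is attained at `j₀ = q` (at `j₀ < q` Thm. 4.6 would force `slope = ρ`)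
  have hj₀q : j₀ = q := by
    rcases Finset.mem_Icc.mp hj₀ with ⟨h1, h2⟩
    by_contra hne'
    have hj₀' : j₀ ∈ Finset.Ico 1 q := Finset.mem_Ico.mpr ⟨h1, lt_of_le_of_ne h2 hne'⟩
    exact hA (h46 j₀ hj₀' (by rw [hsF, hinf]))
  rw [hj₀q] at hinf
  refine ⟨?_, fun j hj => ?_⟩
  · show ordQuot (coeffA q g q) q < ((ρ : ℚ) : WithTop ℚ)
    rw [← hinf, ← hsF]
    exact hlt
  · rcases Finset.mem_Ico.mp hj with ⟨h1, h2⟩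
    have hjIcc : j ∈ Finset.Icc 1 q := Finset.mem_Icc.mpr ⟨h1, h2.le⟩
    have hle : slope q g ρ ≤ ordQuot (coeffA q g j) j := by
      rw [hsF]
      exact Finset.inf_le hjIcc
    have hne' : slope q g ρ ≠ ordQuot (coeffA q g j) j := fun h => hA (h46 j hj h)
    show ordQuot (coeffA q g q) q < ordQuot (coeffA q g j) j
    rw [← hinf, ← hsF]
    exact lt_of_le_of_ne hle hne'

/-- One round of the cleaning procedure of Rem. 5.7 («If this new presentation p𝒫′ … is within Case A), B1) or B2) then
stop. If, on the contrary, f′_{pᵉ}(z′) is in case B3), then …», p.18 l.36–37): under the conclusion of Thm. 4.6 a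
presentation with positive slope is either well-adapted (Def. 5.5 (1)) or in case B3).
[cite: BenitoVillamayoru2013, Rem. 5.7 p.18 l.36–37 with Def. 5.5 (1) p.18 l.20, arXiv v2] -/
theorem isWellAdapted_or_isCaseB3_of_slopeDichotomy {q : ℕ} (hq : 0 < q) {g : S[X]} {ρ : ℚ}
    (h46 : SlopeDichotomy q g ρ) (hpos : 0 < slope q g ρ) : IsWellAdapted q g ρ ∨ IsCaseB3 q g ρ := by
  classical
  rcases isCaseA_or_isCaseB_of_slopeDichotomy hq h46 with hA | hB
  · exact Or.inl (Or.inl ⟨hpos, Or.inl hA⟩)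
  · by_cases hint : SlopeIsPosInt q g
    · by_cases hpow : InitIsPow q (coeffA q g q)
      · exact Or.inr ⟨hB, hint, hpow⟩
      · exact Or.inl (Or.inl ⟨hpos, Or.inr (Or.inr ⟨hB, hint, hpow⟩)⟩)
    · exact Or.inl (Or.inl ⟨hpos, Or.inr (Or.inl ⟨hB, hint⟩)⟩)

end Existence

section ExistenceRegular

variable [IsRegularLocalRing S]

/-- **Rem. 5.7 (Finiteness of the cleaning process), existence clause**, COEFFICIENT FORM, MODULO Thm. 4.6: «This shows
that with this procedure of modification of the transversal section, locally over y, the slope will increase every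
time we come to Case B3). Finally, Remark 4.3 guarantees that Case B3) can arise only finitely many times throughout
this procedure. So ultimately the procedure leads to a well-adapted p-presentation.» Here: `S` a regular local ring of
characteristic `p` (for `𝒪_{V^{(d−1)},y}`), `f` monic of degree `q = pᵉ`, `ρ` for `ord(ℛ_{𝒢,β})(y)`, positive slope
(print's standing assumption of §5.1/§5.2, p.16 l.45–46 / p.17 l.6); HYPOTHESIS `h46`: the conclusion of Thm. 4.6
(`SlopeDichotomy`) for every re-sectioned presentation `f(X + α)`, `α ∈ S` (in print a theorem about `ℛ_{𝒢,β}`, valid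
for all `p`-presentations; not typed). CONCLUSION: some change of section `z ↦ z − α` (`Polynomial.taylor α`) yields
a well-adapted presentation (Def. 5.5, `IsWellAdapted`). Proof as printed: stop in cases A)/B1)/B2)
(`isWellAdapted_or_isCaseB3_of_slopeDichotomy`); in case B3) clean by Prop. 5.3 (`exists_slope_lt_iff_initIsPow`),
the slope being a positive integer `ℓ < ρ` that strictly increases (`slope_eq_natCast_of_isCaseB3`), so at most
`⌈ρ⌉ − 1` cleanings occur; successive changes of section compose (`Polynomial.taylor_taylor`).
[cite: BenitoVillamayoru2013, Rem. 5.7, arXiv v2 p.18 l.29–44] -/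
theorem exists_isWellAdapted_taylor {p : ℕ} (hp : p.Prime) [CharP S p] (e : ℕ) {f : S[X]} (hmon : f.Monic)
    (hdeg : f.natDegree = p ^ e) {ρ : ℚ} (hpos : 0 < slope (p ^ e) f ρ)
    (h46 : ∀ α : S, SlopeDichotomy (p ^ e) (taylor α f) ρ) :
    ∃ α : S, IsWellAdapted (p ^ e) (taylor α f) ρ := by
  classical
  have hq : 0 < p ^ e := pow_pos hp.pos e
  -- every re-sectioned presentation is monic of degree `q`
  have hmonα : ∀ α : S, (taylor α f).Monic := fun α =>
    Monic.def.mpr (by rw [leadingCoeff_taylor]; exact hmon.leadingCoeff)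
  have hdegα : ∀ α : S, (taylor α f).natDegree = p ^ e := fun α => by rw [natDegree_taylor, hdeg]
  -- MAIN CLAIM, by induction on a bound `k` for `⌈ρ⌉ − ℓ`: from a B3-presentation `f(X + α)` of (integer) slope `ℓ`
  -- the procedure reaches a well-adapted presentation
  have key : ∀ k : ℕ, ∀ α : S, ∀ ℓ : ℕ, IsCaseB3 (p ^ e) (taylor α f) ρ →
      slope (p ^ e) (taylor α f) ρ = ((ℓ : ℚ) : WithTop ℚ) → (ℓ : ℚ) < ρ → ⌈ρ⌉₊ - ℓ ≤ k →
      ∃ α' : S, IsWellAdapted (p ^ e) (taylor α' f) ρ := by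
    intro k
    induction k with
    | zero =>
      intro α ℓ _ _ hℓρ hk
      -- `ℓ < ρ ≤ ⌈ρ⌉`, so `⌈ρ⌉ − ℓ = 0` is impossible
      exfalso
      have h1 : ℓ < ⌈ρ⌉₊ := Nat.lt_ceil.mpr hℓρ
      omega
    | succ k ih =>
      intro α ℓ hB3 hs hℓρ hk
      -- clean once (Prop. 5.3, direction ⇐): some `β` raises the slope
      obtain ⟨β, hβ⟩ :=
        (exists_slope_lt_iff_initIsPow hp e (hmonα α) (hdegα α) hB3.1).mpr hB3.2.2
      rw [taylor_taylor] at hβ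
      -- the new presentation `f(X + (β + α))` has positive slope
      obtain ⟨ℓ₀, hℓ₀, hs₀, -⟩ := slope_eq_natCast_of_isCaseB3 hq hB3
      have hpos' : 0 < slope (p ^ e) (taylor (β + α) f) ρ := by
        refine lt_trans ?_ hβ
        rw [hs₀]
        exact_mod_cast hℓ₀
      rcases isWellAdapted_or_isCaseB3_of_slopeDichotomy hq (h46 (β + α)) hpos' with hW | hB3'
      · exact ⟨β + α, hW⟩
      · -- again B3: the slope is a larger integer `ℓ' > ℓ`, still `< ρ`; recurse
        obtain ⟨ℓ', -, hs', hℓ'ρ⟩ := slope_eq_natCast_of_isCaseB3 hq hB3'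
        have hstep : ((ℓ : ℚ) : WithTop ℚ) < ((ℓ' : ℚ) : WithTop ℚ) := by
          rw [← hs, ← hs']
          exact hβ
        have hℓℓ' : ℓ < ℓ' := by exact_mod_cast hstep
        exact ih (β + α) ℓ' hB3' hs' hℓ'ρ (by omega)
  -- START of the procedure at the given section (`α = 0`)
  have h46₀ : SlopeDichotomy (p ^ e) (taylor 0 f) ρ := h46 0
  have hpos₀ : 0 < slope (p ^ e) (taylor 0 f) ρ := by rw [taylor_zero]; exact hpos
  rcases isWellAdapted_or_isCaseB3_of_slopeDichotomy hq h46₀ hpos₀ with hW | hB3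
  · exact ⟨0, hW⟩
  · obtain ⟨ℓ, -, hs, hℓρ⟩ := slope_eq_natCast_of_isCaseB3 hq hB3
    exact key (⌈ρ⌉₊ - ℓ) 0 ℓ hB3 hs hℓρ le_rfl

end ExistenceRegular

/-! ## Pure heads `z^{pᵉ} + a`: Thm. 4.6's hypothesis is vacuous, so Rem. 5.7's existence clause holds outright -/

section Pure

/-- Frobenius re-sectioning of a PURE head: in characteristic `p`, `(z + α)^{pᵉ} + a = z^{pᵉ} + (α^{pᵉ} + a)`, i.e.
`taylor α (X^{pᵉ} + C a) = X^{pᵉ} + C (α^{pᵉ} + a)` — the change of section of §5.2 keeps a purely inseparable head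
purely inseparable ((5.2.1)/(5.2.2) with `a₁ = ⋯ = a_{pᵉ−1} = 0`: `a′_{pᵉ} = α^{pᵉ} + a_{pᵉ}`, `a′_j = 0` otherwise).
[folklore] (freshman's dream, Mathlib `add_pow_char_pow`);
[cite: BenitoVillamayoru2013, (5.2.1)–(5.2.2), arXiv v2 p.17 l.17–19] -/
theorem taylor_X_pow_add_C_charPow {p : ℕ} (hp : p.Prime) [CharP S p] (e : ℕ) (a α : S) :
    taylor α (X ^ (p ^ e) + C a) = X ^ (p ^ e) + C (α ^ (p ^ e) + a) := by
  haveI : Fact p.Prime := ⟨hp⟩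
  rw [taylor_apply, add_comp, X_pow_comp, C_comp, add_pow_char_pow, ← C_pow, C_add]
  ring

/-- For a pure head `z^q + a` every coefficient `a_j` with `1 ≤ j < q` vanishes (unfolding of `coeffA`). [folklore] -/
private theorem coeffA_X_pow_add_C_of_lt {q j : ℕ} (a : S) (hj1 : 1 ≤ j) (hjq : j < q) :
    coeffA q (X ^ q + C a : S[X]) j = 0 := by
  simp only [coeffA, coeff_add, coeff_X_pow, coeff_C]
  have h1 : q - j ≠ q := by omega
  have h2 : q - j ≠ 0 := by omega
  simp [h1, h2]

variable [IsLocalRing S]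

/-- For a pure head `z^q + a` the hypothesis of Thm. 4.6 («`Sl(p𝒫)(y) = ν_y(a_j)/j` for some `j < q`») is VACUOUS:
`a_j = 0`, so `ν_y(a_j)/j = ∞ ≠ Sl(p𝒫)(y) ≤ ord(ℛ_{𝒢,β})(y)`; hence `SlopeDichotomy` holds with nothing to import.
[cite: BenitoVillamayoru2013, Thm. 4.6, arXiv v2 p.14 l.43–45] [folklore] -/
theorem slopeDichotomy_X_pow_add_C (q : ℕ) (a : S) (ρ : ℚ) : SlopeDichotomy q (X ^ q + C a) ρ := by
  intro j hj hslope
  exfalso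
  rcases Finset.mem_Ico.mp hj with ⟨hj1, hjq⟩
  rw [coeffA_X_pow_add_C_of_lt a hj1 hjq, ordQuot_of_eq_top adicOrder_zero] at hslope
  have hle : slope q (X ^ q + C a : S[X]) ρ ≤ ((ρ : ℚ) : WithTop ℚ) := inf_le_right
  rw [hslope] at hle
  exact not_lt_of_ge hle (WithTop.coe_lt_top _)

end Pure

section PureRegular

variable [IsRegularLocalRing S]

/-- **Rem. 5.7, existence clause, for PURE heads `z^{pᵉ} + a` — UNCONDITIONAL** (the special case in which the
hypothesis binder `h46` of `exists_isWellAdapted_taylor` discharges itself: every re-sectioning `z ↦ z − α` of a pure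
head is the pure head `z^{pᵉ} + (α^{pᵉ} + a)`, `taylor_X_pow_add_C_charPow`, for which Thm. 4.6's hypothesis is
vacuous, `slopeDichotomy_X_pow_add_C`): for `S` a regular local ring of characteristic `p` (for `𝒪_{V^{(d−1)},y}`),
`a ∈ S`, `ρ` for `ord(ℛ_{𝒢,β})(y)`, and positive slope of the presentation `z^{pᵉ} + a`, SOME `α ∈ S` makes
`z^{pᵉ} + (α^{pᵉ} + a)` well-adapted (Def. 5.5). This is the purely inseparable cleaning «it suffices to choose α so
that ν_y(α^{pᵉ} + a_{pᵉ}) > ν_y(a_{pᵉ})», iterated finitely often (Rem. 5.7), with no input from the elimination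
algebra beyond the number `ρ`. [cite: BenitoVillamayoru2013, Rem. 5.7, arXiv v2 p.18 l.29–44, with Prop. 5.3 p.18 l.7–8] -/
theorem exists_isWellAdapted_taylor_pure {p : ℕ} (hp : p.Prime) [CharP S p] (e : ℕ) (a : S) {ρ : ℚ}
    (hpos : 0 < slope (p ^ e) (X ^ (p ^ e) + C a) ρ) :
    ∃ α : S, IsWellAdapted (p ^ e) (X ^ (p ^ e) + C (α ^ (p ^ e) + a)) ρ := by
  have hq : p ^ e ≠ 0 := (pow_pos hp.pos e).ne'
  obtain ⟨α, hα⟩ := exists_isWellAdapted_taylor hp e (monic_X_pow_add_C a hq) natDegree_X_pow_add_C hpos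
    (fun α => by rw [taylor_X_pow_add_C_charPow hp e a α]; exact slopeDichotomy_X_pow_add_C _ _ _)
  exact ⟨α, by rw [← taylor_X_pow_add_C_charPow hp e a α]; exact hα⟩

end PureRegular

end BV2013

end Literature.AlgebraicGeometry.Resolution

end
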